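import Literature.NumberTheory.DiophantineGeometry.RamanujanNagellHeightBoundProofs
import Literature.NumberTheory.DiophantineGeometry.SUnitAbcBoundsCongruenceNumber
import HarnessLib

/-!
# von Känel–Matschke, Corollary 9.3 (i): pairs of `S`-units whose sum is a square (proofs)

Topic `Literature/NumberTheory/DiophantineGeometry` (family `abc`). A proofs-only companion (theorems only; NO
definition, NO new named fact; D-0014, D-0026) of `MordellThueRamanujanNagellHeightBounds.lean`, where
**Corollary 9.3** (`cor:sumsofunits`) of R. von Känel, B. Matschke, arXiv:1605.06079 = Mem. AMS 286 (2023),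
no. 1419 [`VonkanelMatschke2023`] is typed (with `Ω' = 3 Ω_sim(1, S) + 9 log N_S`) as `corollary_9_3_sim`:
*"Assume that `u, v` are in `𝒪^×`. (i) If `u + v` is a square in `ℚ`, then there is `ε ∈ 𝒪^×` such that
`h(ε²u), h(ε²v) ≤ Ω`. (ii) If `u + v` is a cube …"*. This file proves part (i) from Corollary 9.1 (itself a
theorem of the tree from the §10 roots, `corollary_9_1_sim_of_roots`); part (ii) and the assembly are in
`SumsOfUnitsCubeProofs.lean`.

## The printed proof (§9) and how it is followed

*"there is `ε ∈ 𝒪^×` such that `ε²u` and `ε²v` are in `ℤ`, with `ε²u + ε²v` a perfect square and `gcd(ε²u, ε²v)`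
square-free"* — `exists_isSUnit_sq_mul_pair` (`ε = ∏_{p ∈ S} p^{−⌊min(ord_p u, ord_p v)/2⌋}`). *"If `m, n` are in
`ℤ ∩ 𝒪^×` with `m + n` a perfect square and `gcd(m, n)` square-free, then (claimsquare) `h(n) ≤ Ω`. To prove this
inequality we take `l ∈ ℤ` with `l² = m + n` and we write `m = m'²m₀` with `m', m₀ ∈ ℤ` such that `m₀ ∣ N_S`
[`exists_sq_mul_of_isSUnit_int`]. Further we define `x = l/m'` and `y = n/m'²`. Then `(x, y)` satisfies (9.1) with
`b = −m₀` and `c = 1`. Thus an application of Corollary 9.1 with `(x, y)` implies (claimsquare). Here we used that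
`n` and `m'` are coprime which follows from our assumption that `gcd(m, n)` is square-free"* — `claimsquare`
(with `Ω_sim`: `3Ω_sim(−m₀, S) = h(m₀) + 3Ω_sim(1, S) ≤ log N_S + 3Ω_sim(1, S)` since `(−m₀)_S = 1_S`, whence the
`9 log N_S`; and `h(n) ≤ h(n/m'²)` by coprimality). *"an application of (claimsquare) with `m = ε²u` and `n = ε²v`
shows that `ε` has the desired properties"* — `corollary_9_3_i_of_corollary_9_1_sim`.

Also proved here (used again for cubes): `S`-integrality / integrality from valuations
(`isSInteger_of_padicValRat_nonneg`, `exists_intCast_of_padicValRat_nonneg`) and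
`h(ε) ≤ k log N_S` when `|ord_p ε| ≤ k` on `S` (`logHeight₁_le_mul_log_primesProd`).
-/

noncomputable section

open Height

namespace Literature.NumberTheory.DiophantineGeometry

namespace VonKanelMatschke

/-! ### Integrality from valuations -/

/-- A rational number all of whose `p`-adic valuations are `≥ 0` is an integer (the case `S = ∅`, `𝒪 = ℤ`, of
membership in `𝒪 = ℤ[1/N_S]`). [cite: VonkanelMatschke2023, §1 (𝒪 = ℤ[1/N_S], case S = ∅)] -/
theorem exists_intCast_of_padicValRat_nonneg {x : ℚ} (h : ∀ p : ℕ, p.Prime → 0 ≤ padicValRat p x) :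
    ∃ z : ℤ, x = z := by
  refine ⟨x.num, ((Rat.den_eq_one_iff x).mp ?_).symm⟩
  by_contra hd
  obtain ⟨p, hp, hpd⟩ := Nat.exists_prime_and_dvd hd
  haveI : Fact p.Prime := ⟨hp⟩
  have hnn : ¬ p ∣ x.num.natAbs := fun hn =>
    hp.one_lt.ne' (Nat.eq_one_of_dvd_one (x.reduced ▸ Nat.dvd_gcd hn hpd))
  have h1 := h p hp
  have h2 : 1 ≤ padicValNat p x.den := one_le_padicValNat_of_dvd x.den_nz hpd
  rw [padicValRat_def, padicValInt, padicValNat.eq_zero_of_not_dvd hnn, Nat.cast_zero, zero_sub,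
    Left.nonneg_neg_iff, Nat.cast_nonpos] at h1
  omega

/-- A rational number with `ord_p ≥ 0` for all `p ∉ S` lies in `𝒪 = ℤ[1/N_S]`. [cite: VonkanelMatschke2023, §1 (𝒪 = ℤ[1/N_S])] -/
theorem isSInteger_of_padicValRat_nonneg {S : Finset ℕ} {x : ℚ}
    (h : ∀ p : ℕ, p.Prime → p ∉ S → 0 ≤ padicValRat p x) : IsSInteger S x := by
  intro p hp
  obtain ⟨hpP, hpd, -⟩ := Nat.mem_primeFactors.mp hp
  by_contra hpS
  haveI : Fact p.Prime := ⟨hpP⟩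
  have hnn : ¬ p ∣ x.num.natAbs := fun hn =>
    hpP.one_lt.ne' (Nat.eq_one_of_dvd_one (x.reduced ▸ Nat.dvd_gcd hn hpd))
  have h1 := h p hpP hpS
  have h2 : 1 ≤ padicValNat p x.den := one_le_padicValNat_of_dvd x.den_nz hpd
  rw [padicValRat_def, padicValInt, padicValNat.eq_zero_of_not_dvd hnn, Nat.cast_zero, zero_sub,
    Left.nonneg_neg_iff, Nat.cast_nonpos] at h1
  omega

/-- An integer is an `S`-unit iff its prime factors lie in `S`; in particular `ord_p = 0` off `S`
characterises `𝒪^×` (`isSUnit_of_padicValRat_eq_zero`). Integers have `ord_p ≥ 0`. [folklore] -/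
private theorem padicValRat_intCast_nonneg (p : ℕ) (z : ℤ) : 0 ≤ padicValRat p (z : ℚ) := by
  rw [padicValRat.of_int]; exact_mod_cast Nat.zero_le _

/-- `−x ∈ 𝒪^×` for `x ∈ 𝒪^×`. [cite: VonkanelMatschke2023, §1 (eq:sunit)] -/
theorem IsSUnit.neg {S : Finset ℕ} {x : ℚ} (h : IsSUnit S x) : IsSUnit S (-x) :=
  ⟨neg_ne_zero.mpr h.1, by rw [Rat.num_neg_eq_neg_num, Int.natAbs_neg]; exact h.2.1,
    by rw [Rat.den_neg_eq_den]; exact h.2.2⟩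

/-! ### `h(ε) ≤ k log N_S` for `|ord_p ε| ≤ k` -/

/-- A nonzero natural number with prime factors in `P` is `∏_{ℓ ∈ P} ℓ^{v_ℓ}`. [folklore] -/
private theorem nat_eq_prod_pow_factorization'' {P : Finset ℕ} {n : ℕ} (hn : n ≠ 0)
    (h : n.primeFactors ⊆ P) : n = ∏ ℓ ∈ P, ℓ ^ n.factorization ℓ := by
  rw [← Finsupp.prod_of_support_subset n.factorization (s := P)
    (by rwa [Nat.support_factorization]) (fun p k => p ^ k) (fun _ _ => pow_zero _)]
  exact (Nat.prod_factorization_pow_eq_self hn).symm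

/-- If `ε ∈ 𝒪^×` has `−k ≤ ord_p(ε) ≤ k` for all `p ∈ S`, then `|num ε| ∣ N_S^k`, `den ε ∣ N_S^k` and so
`h(ε) ≤ k log N_S` (the case `k = 1` is `logHeight₁_le_log_primesProd`; `k = 2`: "`m₀ ∣ N_S²`").
[cite: VonkanelMatschke2023, §9 (proofs of Cor. 9.1 and Cor. 9.3: ε ∣ N_S², m₀ ∣ N_S, m₀ ∣ N_S², w ∣ N_S)] -/
theorem logHeight₁_le_mul_log_primesProd {S : Finset ℕ} (hS : ∀ p ∈ S, p.Prime) {ε : ℚ} (hε : IsSUnit S ε)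
    (k : ℕ) (h1 : ∀ p ∈ S, padicValRat p ε ≤ k) (h2 : ∀ p ∈ S, -(k : ℤ) ≤ padicValRat p ε) :
    logHeight₁ ε ≤ k * Real.log (primesProd S) := by
  have hN := one_le_primesProd hS
  have hnum0 : ε.num.natAbs ≠ 0 := Int.natAbs_ne_zero.mpr (Rat.num_ne_zero.mpr hε.1)
  have hpow : primesProd S ^ k = ∏ ℓ ∈ S, ℓ ^ k := by rw [primesProd, Finset.prod_pow]
  have hnum : ε.num.natAbs ∣ primesProd S ^ k := by
    rw [nat_eq_prod_pow_factorization'' hnum0 hε.2.1, hpow]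
    refine Finset.prod_dvd_prod_of_dvd _ _ fun p hp => pow_dvd_pow p ?_
    have hpP := hS p hp
    haveI : Fact p.Prime := ⟨hpP⟩
    rw [Nat.factorization_def _ hpP]
    by_cases hd : p ∣ ε.num.natAbs
    · have hnd : ¬ p ∣ ε.den := fun hd' =>
        hpP.one_lt.ne' (Nat.eq_one_of_dvd_one (ε.reduced ▸ Nat.dvd_gcd hd hd'))
      have h3 := h1 p hp
      rw [padicValRat_def, padicValInt, padicValNat.eq_zero_of_not_dvd hnd, Nat.cast_zero, sub_zero] at h3
      exact_mod_cast h3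
    · rw [padicValNat.eq_zero_of_not_dvd hd]; exact Nat.zero_le _
  have hden : ε.den ∣ primesProd S ^ k := by
    rw [nat_eq_prod_pow_factorization'' ε.den_nz hε.2.2, hpow]
    refine Finset.prod_dvd_prod_of_dvd _ _ fun p hp => pow_dvd_pow p ?_
    have hpP := hS p hp
    haveI : Fact p.Prime := ⟨hpP⟩
    rw [Nat.factorization_def _ hpP]
    by_cases hd : p ∣ ε.den
    · have hnn : ¬ p ∣ ε.num.natAbs := fun hn =>
        hpP.one_lt.ne' (Nat.eq_one_of_dvd_one (ε.reduced ▸ Nat.dvd_gcd hn hd))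
      have h3 := h2 p hp
      rw [padicValRat_def, padicValInt, padicValNat.eq_zero_of_not_dvd hnn, Nat.cast_zero, zero_sub,
        neg_le_neg_iff] at h3
      exact_mod_cast h3
    · rw [padicValNat.eq_zero_of_not_dvd hd]; exact Nat.zero_le _
  have hNk : 0 < primesProd S ^ k := pow_pos (by omega) k
  have hnum' : ε.num.natAbs ≤ primesProd S ^ k := Nat.le_of_dvd hNk hnum
  have hden' : ε.den ≤ primesProd S ^ k := Nat.le_of_dvd hNk hden
  rw [Rat.logHeight₁_eq_log_max, ← Real.log_pow]
  have hmax : ((max ε.num.natAbs ε.den : ℕ) : ℝ) ≤ (primesProd S : ℝ) ^ k := by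
    exact_mod_cast max_le hnum' hden'
  have hpos : (0 : ℝ) < ((max ε.num.natAbs ε.den : ℕ) : ℝ) := by
    have : 1 ≤ max ε.num.natAbs ε.den := le_max_of_le_right ε.den_pos
    exact_mod_cast this
  exact Real.log_le_log hpos hmax

/-! ### `ε²u, ε²v ∈ ℤ` with square-free gcd -/

/-- **The normalisation of the proof of Cor. 9.3 (i)** (*"there is `ε ∈ 𝒪^×` such that `ε²u` and `ε²v` are in
`ℤ`, with … `gcd(ε²u, ε²v)` square-free"*): `ε = ∏_{p ∈ S} p^{−⌊min(ord_p u, ord_p v)/2⌋}`.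
[cite: VonkanelMatschke2023, §9 (proof of Cor. 9.3 (i))] -/
theorem exists_isSUnit_sq_mul_pair {S : Finset ℕ} (hS : ∀ p ∈ S, p.Prime) {u v : ℚ}
    (hu : IsSUnit S u) (hv : IsSUnit S v) :
    ∃ (ε : ℚ) (m n : ℤ), IsSUnit S ε ∧ ε ^ 2 * u = m ∧ ε ^ 2 * v = n ∧
      IsSUnit S (m : ℚ) ∧ IsSUnit S (n : ℚ) ∧ ∀ p : ℕ, p.Prime → ¬ ((p : ℤ) ^ 2 ∣ m ∧ (p : ℤ) ^ 2 ∣ n) := by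
  classical
  have hu0 := hu.1
  have hv0 := hv.1
  set e : ℕ → ℤ := fun p => min (padicValRat p u) (padicValRat p v) / 2 with he
  set ε : ℚ := ∏ ℓ ∈ S, (ℓ : ℚ) ^ (-e ℓ) with hεdef
  have hε0 : ε ≠ 0 :=
    Finset.prod_ne_zero_iff.mpr fun ℓ hℓ => zpow_ne_zero _ (by exact_mod_cast (hS ℓ hℓ).ne_zero)
  have hvε : ∀ p : ℕ, p.Prime → padicValRat p ε = if p ∈ S then -e p else 0 := by
    intro p hp
    haveI : Fact p.Prime := ⟨hp⟩
    exact padicValRat_prod_natCast_zpow hS (fun ℓ => -e ℓ) p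
  have hεS : IsSUnit S ε := isSUnit_of_padicValRat_eq_zero hε0 fun p hp hpS => by
    rw [hvε p hp, if_neg hpS]
  -- valuations of `ε² u`, `ε² v`
  have hval : ∀ w : ℚ, w ≠ 0 → ∀ p : ℕ, p.Prime →
      padicValRat p (ε ^ 2 * w) = 2 * padicValRat p ε + padicValRat p w := by
    intro w hw p hp
    haveI : Fact p.Prime := ⟨hp⟩
    rw [padicValRat.mul (pow_ne_zero 2 hε0) hw, padicValRat.pow]; push_cast; ring
  have hrem : ∀ p ∈ S, 0 ≤ min (padicValRat p u) (padicValRat p v) - 2 * e p ∧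
      min (padicValRat p u) (padicValRat p v) - 2 * e p ≤ 1 := by
    intro p hp
    have h1 := Int.emod_add_mul_ediv (min (padicValRat p u) (padicValRat p v)) 2
    have h2 := Int.emod_nonneg (min (padicValRat p u) (padicValRat p v)) (by norm_num : (2 : ℤ) ≠ 0)
    have h3 := Int.emod_lt_of_pos (min (padicValRat p u) (padicValRat p v)) (by norm_num : (0 : ℤ) < 2)
    rw [he]; dsimp only; constructor <;> omega
  have hnonneg : ∀ w : ℚ, IsSUnit S w → (∀ p, min (padicValRat p u) (padicValRat p v) ≤ padicValRat p w) →
      ∀ p : ℕ, p.Prime → 0 ≤ padicValRat p (ε ^ 2 * w) := by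
    intro w hw hmin p hp
    rw [hval w hw.1 p hp, hvε p hp]
    split_ifs with hpS
    · have := hrem p hpS; have := hmin p; omega
    · rw [padicValRat_eq_zero_of_isSUnit hw hp hpS]; simp
  have hmu : ∀ p, min (padicValRat p u) (padicValRat p v) ≤ padicValRat p u := fun p => min_le_left _ _
  have hmv : ∀ p, min (padicValRat p u) (padicValRat p v) ≤ padicValRat p v := fun p => min_le_right _ _
  obtain ⟨m, hm⟩ := exists_intCast_of_padicValRat_nonneg (hnonneg u hu hmu)
  obtain ⟨n, hn⟩ := exists_intCast_of_padicValRat_nonneg (hnonneg v hv hmv)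
  have hunitS : ∀ w : ℚ, IsSUnit S w → IsSUnit S (ε ^ 2 * w) := fun w hw =>
    isSUnit_of_padicValRat_eq_zero (mul_ne_zero (pow_ne_zero 2 hε0) hw.1) fun p hp hpS => by
      rw [hval w hw.1 p hp, hvε p hp, if_neg hpS, padicValRat_eq_zero_of_isSUnit hw hp hpS]; simp
  refine ⟨ε, m, n, hεS, hm, hn, hm ▸ hunitS u hu, hn ▸ hunitS v hv, fun p hp ⟨hpm, hpn⟩ => ?_⟩
  haveI : Fact p.Prime := ⟨hp⟩
  have hm0 : m ≠ 0 := by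
    have : (m : ℚ) ≠ 0 := hm ▸ mul_ne_zero (pow_ne_zero 2 hε0) hu0
    exact_mod_cast this
  have hn0 : n ≠ 0 := by
    have : (n : ℚ) ≠ 0 := hn ▸ mul_ne_zero (pow_ne_zero 2 hε0) hv0
    exact_mod_cast this
  have h2m : (2 : ℤ) ≤ padicValRat p (ε ^ 2 * u) := by
    rw [hm, padicValRat.of_int]
    rcases (padicValInt_dvd_iff 2 m).mp hpm with h | h
    · exact absurd h hm0
    · exact_mod_cast h
  have h2n : (2 : ℤ) ≤ padicValRat p (ε ^ 2 * v) := by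
    rw [hn, padicValRat.of_int]
    rcases (padicValInt_dvd_iff 2 n).mp hpn with h | h
    · exact absurd h hn0
    · exact_mod_cast h
  rw [hval u hu0 p hp, hvε p hp] at h2m
  rw [hval v hv0 p hp, hvε p hp] at h2n
  by_cases hpS : p ∈ S
  · rw [if_pos hpS] at h2m h2n
    have := hrem p hpS
    rcases min_choice (padicValRat p u) (padicValRat p v) with h | h <;> omega
  · rw [if_neg hpS, padicValRat_eq_zero_of_isSUnit hu hp hpS] at h2m
    simp at h2m

/-! ### `m = m'² m₀` with `m₀ ∣ N_S` -/

/-- *"we write `m = m'²m₀` with `m', m₀ ∈ ℤ` such that `m₀ ∣ N_S`"* (for `m ∈ ℤ ∩ 𝒪^×`): here `m' = ∏_{p∈S} p^{⌊ord_p m/2⌋}`,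
`m₀ = m/m'²` has `ord_p(m₀) ∈ {0, 1}`, so `h(m₀) ≤ log N_S`. [cite: VonkanelMatschke2023, §9 (proof of Cor. 9.3 (i))] -/
theorem exists_sq_mul_of_isSUnit_int {S : Finset ℕ} (hS : ∀ p ∈ S, p.Prime) {m : ℤ} (hm : IsSUnit S (m : ℚ)) :
    ∃ M m₀ : ℤ, M ≠ 0 ∧ m = M ^ 2 * m₀ ∧ IsSUnit S (M : ℚ) ∧ IsSUnit S (m₀ : ℚ) ∧
      logHeight₁ (m₀ : ℚ) ≤ Real.log (primesProd S) := by
  classical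
  have hm0 : (m : ℚ) ≠ 0 := hm.1
  set q : ℕ → ℤ := fun p => padicValRat p (m : ℚ) / 2 with hq
  set Mq : ℚ := ∏ ℓ ∈ S, (ℓ : ℚ) ^ q ℓ with hMq
  have hMq0 : Mq ≠ 0 :=
    Finset.prod_ne_zero_iff.mpr fun ℓ hℓ => zpow_ne_zero _ (by exact_mod_cast (hS ℓ hℓ).ne_zero)
  have hvM : ∀ p : ℕ, p.Prime → padicValRat p Mq = if p ∈ S then q p else 0 := by
    intro p hp
    haveI : Fact p.Prime := ⟨hp⟩
    exact padicValRat_prod_natCast_zpow hS q p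
  have hq0 : ∀ p, 0 ≤ q p := fun p => by
    rw [hq]; exact Int.ediv_nonneg (padicValRat_intCast_nonneg p m) (by norm_num)
  have hMS : IsSUnit S Mq := isSUnit_of_padicValRat_eq_zero hMq0 fun p hp hpS => by
    rw [hvM p hp, if_neg hpS]
  obtain ⟨M, hM⟩ := exists_intCast_of_padicValRat_nonneg (x := Mq) fun p hp => by
    rw [hvM p hp]; split_ifs <;> simp [hq0 p]
  set m₀q : ℚ := (m : ℚ) / Mq ^ 2 with hm₀q
  have hm₀q0 : m₀q ≠ 0 := div_ne_zero hm0 (pow_ne_zero 2 hMq0)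
  have hvm₀ : ∀ p : ℕ, p.Prime → padicValRat p m₀q = padicValRat p (m : ℚ) - 2 * padicValRat p Mq := by
    intro p hp
    haveI : Fact p.Prime := ⟨hp⟩
    rw [hm₀q, padicValRat.div hm0 (pow_ne_zero 2 hMq0), padicValRat.pow]; push_cast; ring
  have hr : ∀ p ∈ S, padicValRat p m₀q ≤ 1 ∧ -1 ≤ padicValRat p m₀q := by
    intro p hp
    rw [hvm₀ p (hS p hp), hvM p (hS p hp), if_pos hp, hq]
    dsimp only
    have h1 := Int.emod_add_mul_ediv (padicValRat p (m : ℚ)) 2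
    have h2 := Int.emod_nonneg (padicValRat p (m : ℚ)) (by norm_num : (2 : ℤ) ≠ 0)
    have h3 := Int.emod_lt_of_pos (padicValRat p (m : ℚ)) (by norm_num : (0 : ℤ) < 2)
    constructor <;> omega
  have hm₀S : IsSUnit S m₀q := isSUnit_of_padicValRat_eq_zero hm₀q0 fun p hp hpS => by
    rw [hvm₀ p hp, hvM p hp, if_neg hpS, padicValRat_eq_zero_of_isSUnit hm hp hpS]; ring
  obtain ⟨m₀, hm₀⟩ := exists_intCast_of_padicValRat_nonneg (x := m₀q) fun p hp => by
    by_cases hpS : p ∈ S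
    · have h0 := hvm₀ p hp
      rw [hvM p hp, if_pos hpS] at h0
      have h1 := Int.emod_add_mul_ediv (padicValRat p (m : ℚ)) 2
      have h2 := Int.emod_nonneg (padicValRat p (m : ℚ)) (by norm_num : (2 : ℤ) ≠ 0)
      rw [h0, hq]; dsimp only; omega
    · rw [hvm₀ p hp, hvM p hp, if_neg hpS, padicValRat_eq_zero_of_isSUnit hm hp hpS]; simp
  have hM0 : M ≠ 0 := by have : (M : ℚ) ≠ 0 := hM ▸ hMq0; exact_mod_cast this
  refine ⟨M, m₀, hM0, ?_, hM ▸ hMS, hm₀ ▸ hm₀S, hm₀ ▸ logHeight₁_le_log_primesProd hS hm₀S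
    (fun p hp => (hr p hp).1) (fun p hp => (hr p hp).2)⟩
  have : (m : ℚ) = (M : ℚ) ^ 2 * m₀ := by rw [← hM, ← hm₀, hm₀q]; field_simp
  exact_mod_cast this

/-! ### (claimsquare) -/

/-- `h(n) = log|n|` for a nonzero integer. [folklore] -/
private theorem logHeight₁_intCast_eq {n : ℤ} (hn : n ≠ 0) : logHeight₁ (n : ℚ) = Real.log |(n : ℝ)| := by
  rw [Rat.logHeight₁_eq_log_max]
  have h1 : 1 ≤ n.natAbs := Nat.one_le_iff_ne_zero.mpr (Int.natAbs_ne_zero.mpr hn)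
  simp [max_eq_left h1, Nat.cast_natAbs, Int.cast_abs]

/-- `Ω_sim(−m₀, S) = (1/3) h(m₀) + Ω_sim(1, S)` for `m₀ ∈ 𝒪^×` (`(−m₀)_S = 1_S`, `h(1) = 0`).
[cite: VonkanelMatschke2023, §9 (Ω = 3Ω_opt(1,S) + 9 log N_S)] -/
theorem omegaSim_neg_of_isSUnit {S : Finset ℕ} {m₀ : ℚ} (h : IsSUnit S m₀) :
    omegaSim S (-m₀) = 1 / 3 * logHeight₁ m₀ + omegaSim S 1 := by
  have hlev : mordellLevel S (-m₀) = mordellLevel S 1 := by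
    rw [show -m₀ = -m₀ * 1 by ring]; exact mordellLevel_mul_of_isSUnit h.neg one_ne_zero
  simp only [omegaSim, hlev, logHeight₁_neg, logHeight₁_one]
  ring

/-- **(claimsquare)** (PROVED from Cor. 9.1): *"If `m, n` are in `ℤ ∩ 𝒪^×` with `m + n` a perfect square and
`gcd(m, n)` square-free, then `h(n) ≤ Ω`"*, with `Ω' = 3Ω_sim(1, S) + 9 log N_S`.
[cite: VonkanelMatschke2023, §9 (proof of Cor. 9.3 (i), display (claimsquare))] -/
theorem claimsquare (h91 : corollary_9_1_sim) {S : Finset ℕ} (hS : ∀ p ∈ S, p.Prime) {m n l : ℤ}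
    (hm : IsSUnit S (m : ℚ)) (hn : IsSUnit S (n : ℚ)) (hl : l ^ 2 = m + n)
    (hsf : ∀ p : ℕ, p.Prime → ¬ ((p : ℤ) ^ 2 ∣ m ∧ (p : ℤ) ^ 2 ∣ n)) :
    logHeight₁ (n : ℚ) ≤ 3 * omegaSim S 1 + 9 * Real.log (primesProd S) := by
  obtain ⟨M, m₀, hM0, hmeq, hMS, hm₀S, hhm₀⟩ := exists_sq_mul_of_isSUnit_int hS hm
  have hn0 : n ≠ 0 := by have := hn.1; exact_mod_cast this
  have hm₀0 : (m₀ : ℚ) ≠ 0 := hm₀S.1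
  have hMq0 : (M : ℚ) ≠ 0 := hMS.1
  set x : ℚ := (l : ℚ) / M with hx
  set y : ℚ := (n : ℚ) / (M : ℚ) ^ 2 with hy
  -- the equation `x² + (−m₀) = 1 · y`
  have hl' : (l : ℚ) ^ 2 = (M : ℚ) ^ 2 * m₀ + n := by rw [hmeq] at hl; exact_mod_cast hl
  have heq : x ^ 2 + (-(m₀ : ℚ)) = 1 * y := by
    rw [hx, hy, div_pow, hl']; field_simp; ring
  -- `x ∈ 𝒪`, `y ∈ 𝒪^×`
  have hxS : IsSInteger S x := by
    by_cases hl0 : l = 0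
    · rw [hx, hl0]; simpa using isSInteger_intCast S 0
    · refine isSInteger_of_padicValRat_nonneg fun p hp hpS => ?_
      haveI : Fact p.Prime := ⟨hp⟩
      rw [hx, padicValRat.div (by exact_mod_cast hl0) hMq0, padicValRat_eq_zero_of_isSUnit hMS hp hpS,
        sub_zero]
      exact padicValRat_intCast_nonneg p l
  have hy0 : y ≠ 0 := div_ne_zero (by exact_mod_cast hn0) (pow_ne_zero 2 hMq0)
  have hyS : IsSUnit S y := isSUnit_of_padicValRat_eq_zero hy0 fun p hp hpS => by
    haveI : Fact p.Prime := ⟨hp⟩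
    rw [hy, padicValRat.div (by exact_mod_cast hn0) (pow_ne_zero 2 hMq0), padicValRat.pow,
      padicValRat_eq_zero_of_isSUnit hn hp hpS, padicValRat_eq_zero_of_isSUnit hMS hp hpS]; simp
  -- Corollary 9.1 with `b = −m₀`, `c = 1`
  have hb : IsSInteger S (-(m₀ : ℚ)) := by
    have := isSInteger_intCast S (-m₀); push_cast at this; exact this
  have hc : IsSInteger S (1 : ℚ) := by simpa using isSInteger_intCast S 1
  have h := h91 S hS (-(m₀ : ℚ)) 1 (neg_ne_zero.mpr hm₀0) one_ne_zero hb hc x y hxS hyS heq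
  rw [one_pow, mul_one, omegaSim_neg_of_isSUnit hm₀S, logHeight₁_one, mul_zero, add_zero] at h
  have hyb : logHeight₁ y ≤ 3 * omegaSim S 1 + 9 * Real.log (primesProd S) := by
    have := (le_max_right _ _).trans h; linarith
  -- `h(n) ≤ h(y)` since `gcd(n, M) = 1`
  have hcop : IsCoprime n M := by
    rw [Int.isCoprime_iff_gcd_eq_one]
    by_contra hg
    obtain ⟨p, hp, hpg⟩ := Nat.exists_prime_and_dvd hg
    have hpn : (p : ℤ) ∣ n := (Int.natCast_dvd_natCast.mpr hpg).trans (Int.gcd_dvd_left _ _)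
    have hpM : (p : ℤ) ∣ M := (Int.natCast_dvd_natCast.mpr hpg).trans (Int.gcd_dvd_right _ _)
    have hp2m : (p : ℤ) ^ 2 ∣ m := hmeq ▸ (pow_dvd_pow_of_dvd hpM 2).mul_right m₀
    have hpl : (p : ℤ) ∣ l := by
      have : (p : ℤ) ∣ l ^ 2 := by rw [hl]; exact dvd_add (dvd_trans (dvd_pow_self _ two_ne_zero) hp2m) hpn
      exact (Nat.prime_iff_prime_int.mp hp).dvd_of_dvd_pow this
    have hp2n : (p : ℤ) ^ 2 ∣ n := by
      have : (p : ℤ) ^ 2 ∣ m + n := hl ▸ pow_dvd_pow_of_dvd hpl 2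
      exact (dvd_add_right hp2m).mp this
    exact hsf p hp ⟨hp2m, hp2n⟩
  have hM2 : (0 : ℤ) < M ^ 2 := by positivity
  have hyeq : logHeight₁ y = Real.log ((max |n| (M ^ 2) : ℤ) : ℝ) := by
    rw [hy, ← MurtyPasten.logHeight₁_div_eq hM2 (hcop.pow_right (n := 2))]; push_cast; ring_nf
  have hnle : logHeight₁ (n : ℚ) ≤ logHeight₁ y := by
    rw [hyeq, logHeight₁_intCast_eq hn0]
    refine Real.log_le_log (abs_pos.mpr (by exact_mod_cast hn0)) ?_
    have : |n| ≤ max |n| (M ^ 2) := le_max_left _ _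
    have h' : ((|n| : ℤ) : ℝ) ≤ ((max |n| (M ^ 2) : ℤ) : ℝ) := by exact_mod_cast this
    rwa [Int.cast_abs] at h'
  exact hnle.trans hyb

/-! ### Corollary 9.3 (i) -/

/-- **vKM Corollary 9.3 (i) ⟸ Corollary 9.1** (PROVED; `Ω' = 3Ω_sim(1, S) + 9 log N_S`): *"If `u + v` is a square
in `ℚ`, then there is `ε ∈ 𝒪^×` such that `h(ε²u), h(ε²v) ≤ Ω`."* — by (claimsquare) applied to `(ε²u, ε²v)` and
`(ε²v, ε²u)`. [cite: VonkanelMatschke2023, Cor. 9.3 (i) (arXiv §9, cor:sumsofunits)] -/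
theorem corollary_9_3_i_of_corollary_9_1_sim (h91 : corollary_9_1_sim) {S : Finset ℕ}
    (hS : ∀ p ∈ S, p.Prime) {u v : ℚ} (hu : IsSUnit S u) (hv : IsSUnit S v) (hsq : IsSquare (u + v)) :
    ∃ ε : ℚ, IsSUnit S ε ∧
      max (logHeight₁ (ε ^ 2 * u)) (logHeight₁ (ε ^ 2 * v)) ≤
        3 * omegaSim S 1 + 9 * Real.log (primesProd S) := by
  obtain ⟨ε, m, n, hεS, hm, hn, hmS, hnS, hsf⟩ := exists_isSUnit_sq_mul_pair hS hu hv
  obtain ⟨r, hr⟩ := hsq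
  -- `m + n = (ε r)²` is a perfect square
  have hsq' : IsSquare (((m + n : ℤ)) : ℚ) := ⟨ε * r, by push_cast; rw [← hm, ← hn, ← mul_add, hr]; ring⟩
  obtain ⟨l, hl⟩ := (Rat.isSquare_iff.mp hsq').1
  rw [Rat.num_intCast] at hl
  have hl2 : l ^ 2 = m + n := by rw [hl]; ring
  have h1 := claimsquare h91 hS hmS hnS hl2 hsf
  have h2 := claimsquare h91 hS hnS hmS (by rw [hl2, add_comm]) fun p hp h => hsf p hp ⟨h.2, h.1⟩
  refine ⟨ε, hεS, ?_⟩
  rw [hm, hn]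
  exact max_le h2 h1

end VonKanelMatschke

end Literature.NumberTheory.DiophantineGeometry

end
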